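import Summits.SmoothPoincare4.SmoothPoincare4.Theorems.ConvexBisectionAcyclicBisectionExistsHgapTransport
import HarnessLib

/-!
# Dual handles, node Hgap ("T3c-3 WITH DATA"), part A: the registered package `helper_Hgap_transport`
(sub-goal of stub `stub_T3_dualPresentation` (T3), line `modp-braid-orbits`, crux
`ConvexBisection.AcyclicBisectionExists`, item stmt-SmoothPoincare4-10508; wave 6, lead c5, worker G1;
registered sub-goal `helper_Hgap_transport`)

The one-line registered form of part A of the node Hgap (`Hgap_transport`, `…HgapTransport.lean`), trimmed
to the registrable length: for the T3 telescope and `∀ x ∈ N, x.1 ≠ 0` there are a margin `m > 0` and data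
`D₂p` of `W₂` along the dual maps transported by the time-`1` map of X3's universal straightening
`strIso g m hm`, with the `jA`-formula `D₂p.jA = D₂.jA ∘ S_{-1}`, all transported attaching circles in the
flat pages `page g (pageDir |P ++ N| (|P| + j))`, and non-zero shadows.  (The margin clause, `jB`, and the
bridges (R1p), (R2p) are the remaining fields of `Hgap_transport`; the bridges also follow from the
`jA`-formula by `helper_transport_bridges`.)

Everything is proved; no named facts, no `sorry`, no `def`.

## References
* R. İ. Baykur, *Kähler decomposition of 4-manifolds*, AGT 6 (2006), proof of Thm. 5.1, pp. 13–14. [Baykur2006]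
-/

noncomputable section

-- the prescribed namespace `Summit.<P>.<Sub>.…` duplicates `SmoothPoincare4` (P = Sub)
set_option linter.dupNamespace false

open scoped Manifold ContDiff Topology

namespace Summit.SmoothPoincare4.SmoothPoincare4.Theorems.AcyclicBisectionExists.ModpBraidOrbits

open Set Function Metric
open Literature.Topology.FourManifolds Literature.Topology.FourManifolds.HandleAttachingMap
  Literature.Topology.FourManifolds.LefschetzBase

/-- **Sub-goal `helper_Hgap_transport` of stub `stub_T3_dualPresentation`** (node Hgap, part A = the fibred
straightened dual presentation; wave 6, lead c5): margin, transported dual data with the `jA`-formula, flat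
pages, non-zero shadows (package of `Hgap_transport`). [cite: Baykur2006, Thm. 5.1 (proof, pp. 13–14)] -/
theorem helper_Hgap_transport : ∀ (g : ℕ) (P N : List ((Fin g ⊕ Fin g → ℤ) × Bool)) (h : Fin (P ++ N).length → Literature.Topology.FourManifolds.HandleAttachingMap 3 2 (Literature.Topology.FourManifolds.LefschetzBase.Base g)) (_ : Literature.Topology.FourManifolds.LefschetzBase.IsLefschetzLink g (P ++ N) h) {X : Type} [TopologicalSpace X] [T2Space X] [SecondCountableTopology X] [CompactSpace X] [ChartedSpace (EuclideanHalfSpace 4) X] [IsManifold (𝓡∂ 4) ∞ X] (D : Literature.Topology.FourManifolds.HandleAttachingMap.MultiAttachmentData h (𝓡∂ 4) X) (bX : Literature.Topology.FourManifolds.BoundaryData (𝓡∂ 4) X (𝓡 3)) (Ψ : bX.carrier ≃ₘ⟮𝓡 3, 𝓡 3⟯ (Literature.Topology.FourManifolds.LefschetzBase.bBase g).carrier) (_ : ∀ (y : bX.carrier) (a : ↥(Literature.Topology.FourManifolds.HandleAttachingMap.coresComplement h)), bX.incl y = D.jA a → ∃ c : ℝ, 0 < c ∧ Literature.Topology.FourManifolds.LefschetzBase.w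 g ((Literature.Topology.FourManifolds.LefschetzBase.bBase g).incl (Ψ y)).1 = (c : ℂ) * Literature.Topology.FourManifolds.LefschetzBase.w g (a : Literature.Topology.FourManifolds.LefschetzBase.Base g).1) {W₂ : Type} [TopologicalSpace W₂] [ChartedSpace (EuclideanHalfSpace 4) W₂] (col : (Literature.Topology.FourManifolds.BoundaryManifold.boundaryData 3 (Literature.Topology.FourManifolds.LefschetzBase.Base g)).Collar) (κ δ : ℝ) (hκ : 0 < κ) (hκ1 : κ ≤ 1) (hδ : 0 < δ) (hδ2 : δ ≤ 1 / 2) (D₂ : Literature.Topology.FourManifolds.HandleAttachingMap.MultiAttachmentData (fun j : Fin N.length => Summit.SmoothPoincare4.SmoothPoincare4.Theorems.AcyclicBisectionExists.ModpBraidOrbits.dualMap D bX (Literature.Topology.FourManifolds.LefschetzBase.bBase g) Ψ col κ δ hκ hκ1 hδ hδ2 (Fin.cast List.length_append.symm (Fin.natAdd P.length j))) (𝓡∂ 4) W₂), (∀ x ∈ N, x.1 ≠ 0) → ∃ (m : ℝ) (hm : 0 < m) (D₂p : Literature.Topology.FourManifolds.HandleAttachingMap.MultiAttachmentData (fun j :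 Fin N.length => (Summit.SmoothPoincare4.SmoothPoincare4.Theorems.AcyclicBisectionExists.ModpBraidOrbits.dualMap D bX (Literature.Topology.FourManifolds.LefschetzBase.bBase g) Ψ col κ δ hκ hκ1 hδ hδ2 (Fin.cast List.length_append.symm (Fin.natAdd P.length j))).transport ((Summit.SmoothPoincare4.SmoothPoincare4.Theorems.AcyclicBisectionExists.ModpBraidOrbits.strIso g m hm).toDiffeomorph 1)) (𝓡∂ 4) W₂), (∀ a, D₂p.jA a = D₂.jA (Literature.Topology.FourManifolds.HandleAttachingMap.coresComplementCongr _ _ a)) ∧ (∀ (j : Fin N.length) (θ : Metric.sphere (0 : EuclideanSpace ℝ (Fin 2)) 1), ((Summit.SmoothPoincare4.SmoothPoincare4.Theorems.AcyclicBisectionExists.ModpBraidOrbits.dualMap D bX (Literature.Topology.FourManifolds.LefschetzBase.bBase g) Ψ col κ δ hκ hκ1 hδ hδ2 (Fin.cast List.length_append.symm (Fin.natAdd P.length j))).transport ((Summit.SmoothPoincare4.SmoothPoincare4.Theorems.AcyclicBisectionExists.ModpBraidOrbits.strIso g m hm).toDiffeomorph 1)).attachingCircle θ ∈ Literature.Topology.FourManifolds.LefschetzBase.page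 g (Literature.Topology.FourManifolds.LefschetzBase.pageDir (P ++ N).length (P.length + j))) ∧ (∀ j : Fin N.length, Literature.Topology.FourManifolds.LefschetzBase.shadow g ((Summit.SmoothPoincare4.SmoothPoincare4.Theorems.AcyclicBisectionExists.ModpBraidOrbits.dualMap D bX (Literature.Topology.FourManifolds.LefschetzBase.bBase g) Ψ col κ δ hκ hκ1 hδ hδ2 (Fin.cast List.length_append.symm (Fin.natAdd P.length j))).transport ((Summit.SmoothPoincare4.SmoothPoincare4.Theorems.AcyclicBisectionExists.ModpBraidOrbits.strIso g m hm).toDiffeomorph 1)).attachingCircle ((Summit.SmoothPoincare4.SmoothPoincare4.Theorems.AcyclicBisectionExists.ModpBraidOrbits.dualMap D bX (Literature.Topology.FourManifolds.LefschetzBase.bBase g) Ψ col κ δ hκ hκ1 hδ hδ2 (Fin.cast List.length_append.symm (Fin.natAdd P.length j))).transport ((Summit.SmoothPoincare4.SmoothPoincare4.Theorems.AcyclicBisectionExists.ModpBraidOrbits.strIso g m hm).toDiffeomorph 1)).continuous_attachingCircle ≠ 0) := by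
  intro g P N h hlink X _ _ _ _ _ _ D bX Ψ hpage W₂ _ _ col κ δ hκ hκ1 hδ hδ2 D₂ hN0
  obtain ⟨m, hm, D₂p, -, hA, -, hpg, hsh, -, -⟩ :=
    Hgap_transport g P N h hlink D bX Ψ hpage col κ δ hκ hκ1 hδ hδ2 D₂ hN0
  exact ⟨m, hm, D₂p, hA, hpg, hsh⟩

end Summit.SmoothPoincare4.SmoothPoincare4.Theorems.AcyclicBisectionExists.ModpBraidOrbits

end
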